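import Literature.Geometry.Lorentzian.MomentPartitionVec
import HarnessLib

/-!
# Killing-moment-corrected splitting of a vector density along a chain of sets (bookkeeping for Lemma 2.2, `T`)

(trunk G08 = T-LORENTZ; family `gr`; namespace `Literature.Geometry.Lorentzian.MaoOhTao`.)

Mao–Oh–Tao (arXiv:2308.13031), proof of Lemma 2.2 (p. 9), "the case of `T` being similar": the vector analogue of
`MomentChainSplit`.  Along a chain `V₀, …, V_N` with FIXED cut-offs `φ_k` and bumps `η_k` (in `V_k ∩ V_{k−1}`), a vector
density `F` is split LINEARLY into pieces supported in the `V_k` whose six Killing moments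
`∫ F · K_a` (`K_a = e_l, Y_l`, `MomentPartitionVec.killingFn`) are handed down the chain with the dual bump fields
`θ^a[η]` (`thetaK`):

* `chainMomentK φ N F k a = Σ_{k ≤ i ≤ N} ∫ (F φ_i) · K_a` — Killing moments of the tail mass;
* `chainPieceK φ η N F k j = F_j φ_k + [k+1 ≤ N] Σ_a M_{k+1}^a (θ^a[η_{k+1}])_j − [1 ≤ k] Σ_a M_k^a (θ^a[η_k])_j`.

Proved: linearity, vanishing/support, continuity / `Cⁿ` / compact support, telescoping `Σ_k chainPieceK F k = F Σφ`,
and the Killing-moment identities (pieces `k ≥ 1` are moment-free; piece `0` carries the moments of `F Σφ`).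

## References

* Y. Mao, S.-J. Oh, T. Tao, arXiv:2308.13031 (2023), Lemma 2.2 and its proof, pp. 8–9 (key `MaoOhTao2023`).
-/

noncomputable section

open scoped RealInnerProductSpace Topology ContDiff
open Filter MeasureTheory Set Metric Function

namespace Literature.Geometry.Lorentzian

namespace MaoOhTao

variable {φ η : ℕ → E3 → ℝ} {N : ℕ} {F G : Fin 3 → E3 → ℝ}

/-- **Tail Killing moments** `M_k^a = Σ_{k ≤ i ≤ N} ∫ (F φ_i) · K_a`. [cite: MaoOhTao2023, Lemma 2.2 (proof)] -/
def chainMomentK (φ : ℕ → E3 → ℝ) (N : ℕ) (F : Fin 3 → E3 → ℝ) (k : ℕ) (a : Fin 3 ⊕ Fin 3) : ℝ :=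
  ∑ i ∈ Finset.Icc k N, ∫ y : E3, ∑ j, F j y * φ i y * killingFn a y j

/-- **The vector mass assigned to the `k`-th set of the chain** (component `j`).
[cite: MaoOhTao2023, Lemma 2.2 (proof)] -/
def chainPieceK (φ η : ℕ → E3 → ℝ) (N : ℕ) (F : Fin 3 → E3 → ℝ) (k : ℕ) (j : Fin 3) (x : E3) : ℝ :=
  F j x * φ k x + (if k + 1 ≤ N then ∑ a, chainMomentK φ N F (k + 1) a * thetaK (η (k + 1)) a x j else 0) -
    (if 1 ≤ k then ∑ a, chainMomentK φ N F k a * thetaK (η k) a x j else 0)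

/-! ### Algebra of the tail moments -/

/-- `M_k = m_k + M_{k+1}` for `k ≤ N`. [folklore] -/
theorem chainMomentK_eq_add (φ : ℕ → E3 → ℝ) {N k : ℕ} (hk : k ≤ N) (F : Fin 3 → E3 → ℝ) (a : Fin 3 ⊕ Fin 3) :
    chainMomentK φ N F k a = (∫ y : E3, ∑ j, F j y * φ k y * killingFn a y j) + chainMomentK φ N F (k + 1) a := by
  simp only [chainMomentK]
  have h : Finset.Icc k N = insert k (Finset.Icc (k + 1) N) := by
    ext i
    simp only [Finset.mem_Icc, Finset.mem_insert]
    omega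
  rw [h, Finset.sum_insert]
  simp

/-- `M_{N+1} = 0`. [folklore] -/
theorem chainMomentK_succ_eq_zero (φ : ℕ → E3 → ℝ) (N : ℕ) (F : Fin 3 → E3 → ℝ) (a : Fin 3 ⊕ Fin 3) :
    chainMomentK φ N F (N + 1) a = 0 := by
  simp [chainMomentK]

/-- `M_0 = ∫ (F Σ_{i ≤ N} φ_i) · K_a` for `F ∈ C_c`, `φ_i` continuous. [folklore] -/
theorem chainMomentK_zero_eq (hφ : ∀ i, Continuous (φ i)) (N : ℕ) (hF : ∀ j, Continuous (F j))
    (hFc : ∀ j, HasCompactSupport (F j)) (a : Fin 3 ⊕ Fin 3) :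
    chainMomentK φ N F 0 a = ∫ y : E3, ∑ j, F j y * (∑ i ∈ Finset.range (N + 1), φ i y) * killingFn a y j := by
  simp only [chainMomentK]
  rw [show Finset.Icc 0 N = Finset.range (N + 1) from by ext i; simp]
  rw [← integral_finsetSum _ fun i _ ↦ integrable_sum_mul_mul_killingFn hF hFc (hφ i) a]
  refine integral_congr_ae (ae_of_all _ fun y ↦ ?_)
  simp only [Finset.mul_sum, Finset.sum_mul]
  rw [Finset.sum_comm]

/-- Linearity of the tail moments in `F`. [folklore] -/
theorem chainMomentK_add_smul (hφ : ∀ i, Continuous (φ i)) (N : ℕ) (hF : ∀ j, Continuous (F j))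
    (hFc : ∀ j, HasCompactSupport (F j)) (hG : ∀ j, Continuous (G j)) (hGc : ∀ j, HasCompactSupport (G j))
    (c d : ℝ) (k : ℕ) (a : Fin 3 ⊕ Fin 3) :
    chainMomentK φ N (fun j x ↦ c * F j x + d * G j x) k a = c * chainMomentK φ N F k a + d * chainMomentK φ N G k a := by
  simp only [chainMomentK, Finset.mul_sum, ← Finset.sum_add_distrib]
  refine Finset.sum_congr rfl fun i _ ↦ ?_
  have h1 := integrable_sum_mul_mul_killingFn hF hFc (hφ i) a
  have h2 := integrable_sum_mul_mul_killingFn hG hGc (hφ i) a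
  rw [← integral_const_mul, ← integral_const_mul, ← integral_add (h1.const_mul c) (h2.const_mul d)]
  refine integral_congr_ae (ae_of_all _ fun y ↦ ?_)
  simp only [Finset.mul_sum, ← Finset.sum_add_distrib]
  exact Finset.sum_congr rfl fun j _ ↦ by ring

/-! ### Linearity, vanishing, regularity -/

/-- **Linearity** of the pieces in `F`. [cite: MaoOhTao2023, Lemma 2.2 (proof)] -/
theorem chainPieceK_add_smul (hφ : ∀ i, Continuous (φ i)) (η : ℕ → E3 → ℝ) (N : ℕ) (hF : ∀ j, Continuous (F j))
    (hFc : ∀ j, HasCompactSupport (F j)) (hG : ∀ j, Continuous (G j)) (hGc : ∀ j, HasCompactSupport (G j))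
    (c d : ℝ) (k : ℕ) (j : Fin 3) (x : E3) :
    chainPieceK φ η N (fun j x ↦ c * F j x + d * G j x) k j x =
      c * chainPieceK φ η N F k j x + d * chainPieceK φ η N G k j x := by
  simp only [chainPieceK, chainMomentK_add_smul hφ N hF hFc hG hGc]
  split_ifs <;> simp only [add_mul, Finset.sum_add_distrib, mul_assoc, ← Finset.mul_sum] <;> ring

/-- The pieces vanish wherever `F_j φ_k`, `η_{k+1}` (if `k + 1 ≤ N`) and `η_k` (if `1 ≤ k`) vanish. [folklore] -/
theorem chainPieceK_eq_zero (φ η : ℕ → E3 → ℝ) (N : ℕ) (F : Fin 3 → E3 → ℝ) (k : ℕ) {j : Fin 3} {x : E3}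
    (h0 : F j x * φ k x = 0) (h1 : k + 1 ≤ N → η (k + 1) x = 0) (h2 : 1 ≤ k → η k x = 0) :
    chainPieceK φ η N F k j x = 0 := by
  simp only [chainPieceK, h0, zero_add]
  have e1 : (if k + 1 ≤ N then ∑ a, chainMomentK φ N F (k + 1) a * thetaK (η (k + 1)) a x j else 0) = 0 := by
    split_ifs with hk
    · simp [thetaK_eq_zero_of_eta _ _ (h1 hk)]
    · rfl
  have e2 : (if 1 ≤ k then ∑ a, chainMomentK φ N F k a * thetaK (η k) a x j else 0) = 0 := by
    split_ifs with hk
    · simp [thetaK_eq_zero_of_eta _ _ (h2 hk)]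
    · rfl
  rw [e1, e2, sub_zero]

/-- **Support in a set `V`**: if `F_j φ_k`, `η_{k+1}`, `η_k` vanish off `V`, so does the piece.
[cite: MaoOhTao2023, Lemma 2.2 (proof)] -/
theorem chainPieceK_eq_zero_of_notMem (φ η : ℕ → E3 → ℝ) (N : ℕ) (F : Fin 3 → E3 → ℝ) (k : ℕ) {V : Set E3}
    (h0 : ∀ j x, x ∉ V → F j x * φ k x = 0) (h1 : k + 1 ≤ N → ∀ x, x ∉ V → η (k + 1) x = 0)
    (h2 : 1 ≤ k → ∀ x, x ∉ V → η k x = 0) (j : Fin 3) {x : E3} (hx : x ∉ V) : chainPieceK φ η N F k j x = 0 :=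
  chainPieceK_eq_zero φ η N F k (h0 j x hx) (fun hk ↦ h1 hk x hx) (fun hk ↦ h2 hk x hx)

/-- **Continuity** of the pieces. [folklore] -/
theorem continuous_chainPieceK (hφ : ∀ i, Continuous (φ i)) (hη : ∀ i, Continuous (η i)) (N : ℕ)
    (hF : ∀ j, Continuous (F j)) (k : ℕ) (j : Fin 3) : Continuous (chainPieceK φ η N F k j) := by
  unfold chainPieceK
  refine (((hF j).mul (hφ k)).add ?_).sub ?_
  · split_ifs
    · exact continuous_finsetSum _ fun a _ ↦ continuous_const.mul (continuous_thetaK (hη _) a j)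
    · exact continuous_const
  · split_ifs
    · exact continuous_finsetSum _ fun a _ ↦ continuous_const.mul (continuous_thetaK (hη _) a j)
    · exact continuous_const

/-- **`Cⁿ` regularity** of the pieces. [folklore] -/
theorem contDiff_chainPieceK {n : ℕ∞ω} (hφ : ∀ i, ContDiff ℝ n (φ i)) (hη : ∀ i, ContDiff ℝ n (η i)) (N : ℕ)
    (hF : ∀ j, ContDiff ℝ n (F j)) (k : ℕ) (j : Fin 3) : ContDiff ℝ n (chainPieceK φ η N F k j) := by
  unfold chainPieceK
  refine (((hF j).mul (hφ k)).add ?_).sub ?_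
  · split_ifs
    · exact ContDiff.sum fun a _ ↦ contDiff_const.mul (contDiff_thetaK (hη _) a j)
    · exact contDiff_const
  · split_ifs
    · exact ContDiff.sum fun a _ ↦ contDiff_const.mul (contDiff_thetaK (hη _) a j)
    · exact contDiff_const

/-- **Compact support** of the pieces. [folklore] -/
theorem hasCompactSupport_chainPieceK (φ : ℕ → E3 → ℝ) (hηc : ∀ i, HasCompactSupport (η i)) (N : ℕ)
    (hFc : ∀ j, HasCompactSupport (F j)) (k : ℕ) (j : Fin 3) : HasCompactSupport (chainPieceK φ η N F k j) := by
  refine HasCompactSupport.intro (((hFc j).union (hηc (k + 1))).union (hηc k)) fun x hx ↦ ?_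
  simp only [mem_union, not_or] at hx
  obtain ⟨⟨h0, h1⟩, h2⟩ := hx
  exact chainPieceK_eq_zero φ η N F k (by rw [image_eq_zero_of_notMem_tsupport h0, zero_mul])
    (fun _ ↦ image_eq_zero_of_notMem_tsupport h1) (fun _ ↦ image_eq_zero_of_notMem_tsupport h2)

/-! ### Telescoping and Killing moments -/

/-- **Telescoping**: `Σ_{k ≤ N} chainPieceK F k j = F_j · Σ_{k ≤ N} φ_k`. [cite: MaoOhTao2023, Lemma 2.2 (proof)] -/
theorem sum_chainPieceK_eq (φ η : ℕ → E3 → ℝ) (N : ℕ) (F : Fin 3 → E3 → ℝ) (j : Fin 3) (x : E3) :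
    ∑ k ∈ Finset.range (N + 1), chainPieceK φ η N F k j x = F j x * ∑ k ∈ Finset.range (N + 1), φ k x := by
  set A : ℕ → ℝ := fun k ↦ if 1 ≤ k ∧ k ≤ N then ∑ a, chainMomentK φ N F k a * thetaK (η k) a x j else 0 with hA
  have hpiece : ∀ k ∈ Finset.range (N + 1), chainPieceK φ η N F k j x = F j x * φ k x + (A (k + 1) - A k) := by
    intro k hk
    rw [Finset.mem_range, Nat.lt_succ_iff] at hk
    simp only [chainPieceK, hA]
    have e1 : (if k + 1 ≤ N then ∑ a, chainMomentK φ N F (k + 1) a * thetaK (η (k + 1)) a x j else 0) =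
        if 1 ≤ k + 1 ∧ k + 1 ≤ N then ∑ a, chainMomentK φ N F (k + 1) a * thetaK (η (k + 1)) a x j else 0 := by
      by_cases h : k + 1 ≤ N
      · rw [if_pos h, if_pos ⟨by omega, h⟩]
      · rw [if_neg h, if_neg (fun h' ↦ h h'.2)]
    have e2 : (if 1 ≤ k then ∑ a, chainMomentK φ N F k a * thetaK (η k) a x j else 0) =
        if 1 ≤ k ∧ k ≤ N then ∑ a, chainMomentK φ N F k a * thetaK (η k) a x j else 0 := by
      by_cases h : 1 ≤ k
      · rw [if_pos h, if_pos ⟨h, hk⟩]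
      · rw [if_neg h, if_neg (fun h' ↦ h h'.1)]
    rw [e1, e2]
    ring
  rw [Finset.sum_congr rfl hpiece, Finset.sum_add_distrib, Finset.sum_range_sub A, Finset.mul_sum]
  have hA0 : A 0 = 0 := by simp [hA]
  have hAN : A (N + 1) = 0 := by
    simp only [hA]
    rw [if_neg]
    omega
  rw [hA0, hAN, sub_zero, add_zero]

/-- If `Σ_{k ≤ N} φ_k = 1` wherever some component of `F` is nonzero, the pieces sum to `F`.
[cite: MaoOhTao2023, Lemma 2.2 (proof)] -/
theorem sum_chainPieceK_eq_self (φ η : ℕ → E3 → ℝ) (N : ℕ) (F : Fin 3 → E3 → ℝ)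
    (hsum : ∀ j x, F j x ≠ 0 → ∑ k ∈ Finset.range (N + 1), φ k x = 1) (j : Fin 3) (x : E3) :
    ∑ k ∈ Finset.range (N + 1), chainPieceK φ η N F k j x = F j x := by
  rw [sum_chainPieceK_eq]
  by_cases hx : F j x = 0
  · rw [hx, zero_mul]
  · rw [hsum j x hx, mul_one]

/-- A vector correction sum `Σ_a c_a θ^a[ζ]` has compactly supported components. [folklore] -/
theorem hasCompactSupport_sum_mul_thetaK {ζ : E3 → ℝ} (hζc : HasCompactSupport ζ) (c : Fin 3 ⊕ Fin 3 → ℝ)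
    (j : Fin 3) : HasCompactSupport fun x : E3 ↦ ∑ a, c a * thetaK ζ a x j := by
  refine HasCompactSupport.intro hζc fun x hx ↦ ?_
  simp [thetaK_eq_zero_of_eta _ _ (image_eq_zero_of_notMem_tsupport hx)]

/-- Integrability of a vector correction sum against `K_{a'}`. [folklore] -/
theorem integrable_sum_sum_mul_thetaK_killingFn {ζ : E3 → ℝ} (hζ : Continuous ζ) (hζc : HasCompactSupport ζ)
    (c : Fin 3 ⊕ Fin 3 → ℝ) (a' : Fin 3 ⊕ Fin 3) :
    Integrable fun x : E3 ↦ ∑ j, (∑ a, c a * thetaK ζ a x j) * killingFn a' x j :=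
  integrable_finsetSum _ fun j _ ↦ ((continuous_finsetSum _ fun a _ ↦ continuous_const.mul
    (continuous_thetaK hζ a j)).mul (continuous_killingFn a' j)).integrable_of_hasCompactSupport
      (hasCompactSupport_sum_mul_thetaK hζc c j).mul_right

/-- Killing moments of a vector correction sum: `∫ (Σ_a c_a θ^a[ζ]) · K_{a'} = c_{a'}`. [folklore] -/
theorem integral_sum_sum_mul_thetaK_killingFn {ζ : E3 → ℝ} (hζ : Continuous ζ) (hζc : HasCompactSupport ζ) {x₀ : E3}
    (hx₀ : ζ x₀ ≠ 0) (c : Fin 3 ⊕ Fin 3 → ℝ) (a' : Fin 3 ⊕ Fin 3) :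
    ∫ x : E3, ∑ j, (∑ a, c a * thetaK ζ a x j) * killingFn a' x j = c a' := by
  have hθ : ∀ a, Integrable fun x : E3 ↦ ∑ j, thetaK ζ a x j * killingFn a' x j := fun a ↦
    integrable_finsetSum _ fun j _ ↦ ((continuous_thetaK hζ a j).mul
      (continuous_killingFn a' j)).integrable_of_hasCompactSupport (hasCompactSupport_thetaK hζc a j).mul_right
  have h2 : ∀ a, Integrable fun x : E3 ↦ c a * ∑ j, thetaK ζ a x j * killingFn a' x j := fun a ↦ (hθ a).const_mul _
  have e1 : (fun x : E3 ↦ ∑ j, (∑ a, c a * thetaK ζ a x j) * killingFn a' x j) =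
      fun x ↦ ∑ a, c a * ∑ j, thetaK ζ a x j * killingFn a' x j := by
    funext x
    simp only [Finset.sum_mul, Finset.mul_sum]
    rw [Finset.sum_comm]
    exact Finset.sum_congr rfl fun a _ ↦ Finset.sum_congr rfl fun j _ ↦ by ring
  rw [e1, integral_finsetSum _ fun a _ ↦ h2 a]
  simp only [integral_const_mul, integral_thetaK_killingFn hζ hζc hx₀, mul_ite, mul_one, mul_zero,
    Finset.sum_ite_eq', Finset.mem_univ, if_true]

/-- Integrability of `Σ_j pieceK_j K_{a'}^j`. [folklore] -/
theorem integrable_sum_chainPieceK_mul_killingFn (hφ : ∀ i, Continuous (φ i)) (hη : ∀ i, Continuous (η i))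
    (hηc : ∀ i, HasCompactSupport (η i)) (N : ℕ) (hF : ∀ j, Continuous (F j)) (hFc : ∀ j, HasCompactSupport (F j))
    (k : ℕ) (a' : Fin 3 ⊕ Fin 3) :
    Integrable fun x : E3 ↦ ∑ j, chainPieceK φ η N F k j x * killingFn a' x j :=
  integrable_finsetSum _ fun j _ ↦ ((continuous_chainPieceK hφ hη N hF k j).mul
    (continuous_killingFn a' j)).integrable_of_hasCompactSupport
      (hasCompactSupport_chainPieceK φ hηc N hFc k j).mul_right

/-- **The pieces `k ≥ 1` are Killing-moment-free** (`1 ≤ k ≤ N`; each `η_i` nonzero somewhere).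
[cite: MaoOhTao2023, Lemma 2.2 (proof)] -/
theorem integral_chainPieceK_killingFn_eq_zero (hφ : ∀ i, Continuous (φ i)) (hη : ∀ i, Continuous (η i))
    (hηc : ∀ i, HasCompactSupport (η i)) {p : ℕ → E3} (hp : ∀ i, 1 ≤ i → i ≤ N → η i (p i) ≠ 0)
    (hF : ∀ j, Continuous (F j)) (hFc : ∀ j, HasCompactSupport (F j)) {k : ℕ} (hk1 : 1 ≤ k) (hkN : k ≤ N)
    (a' : Fin 3 ⊕ Fin 3) : ∫ x : E3, ∑ j, chainPieceK φ η N F k j x * killingFn a' x j = 0 := by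
  have I0 : Integrable fun x : E3 ↦ ∑ j, F j x * φ k x * killingFn a' x j :=
    integrable_sum_mul_mul_killingFn hF hFc (hφ k) a'
  have Ith : ∀ (i : ℕ) (c : Fin 3 ⊕ Fin 3 → ℝ),
      Integrable fun x : E3 ↦ ∑ j, (∑ a, c a * thetaK (η i) a x j) * killingFn a' x j := fun i c ↦
    integrable_sum_sum_mul_thetaK_killingFn (hη i) (hηc i) c a'
  by_cases hkN' : k + 1 ≤ N
  · have e : (fun x : E3 ↦ ∑ j, chainPieceK φ η N F k j x * killingFn a' x j) = fun x ↦
        (∑ j, F j x * φ k x * killingFn a' x j) +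
          (∑ j, (∑ a, chainMomentK φ N F (k + 1) a * thetaK (η (k + 1)) a x j) * killingFn a' x j) -
          ∑ j, (∑ a, chainMomentK φ N F k a * thetaK (η k) a x j) * killingFn a' x j := by
      funext x
      simp only [chainPieceK, if_pos hkN', if_pos hk1, ← Finset.sum_add_distrib, ← Finset.sum_sub_distrib]
      exact Finset.sum_congr rfl fun j _ ↦ by ring
    have I01 : Integrable fun x : E3 ↦ (∑ j, F j x * φ k x * killingFn a' x j) +
        ∑ j, (∑ a, chainMomentK φ N F (k + 1) a * thetaK (η (k + 1)) a x j) * killingFn a' x j := I0.add (Ith _ _)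
    rw [e, integral_sub I01 (Ith _ _), integral_add I0 (Ith _ _),
      integral_sum_sum_mul_thetaK_killingFn (hη _) (hηc _) (hp (k + 1) (by omega) hkN') _ a',
      integral_sum_sum_mul_thetaK_killingFn (hη _) (hηc _) (hp k hk1 hkN) _ a', chainMomentK_eq_add φ hkN F a']
    ring
  · have hkN2 : k = N := by omega
    have e : (fun x : E3 ↦ ∑ j, chainPieceK φ η N F k j x * killingFn a' x j) = fun x ↦
        (∑ j, F j x * φ k x * killingFn a' x j) -
          ∑ j, (∑ a, chainMomentK φ N F k a * thetaK (η k) a x j) * killingFn a' x j := by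
      funext x
      simp only [chainPieceK, if_neg hkN', if_pos hk1, add_zero, ← Finset.sum_sub_distrib]
      exact Finset.sum_congr rfl fun j _ ↦ by ring
    rw [e, integral_sub I0 (Ith _ _), integral_sum_sum_mul_thetaK_killingFn (hη _) (hηc _) (hp k hk1 hkN) _ a',
      chainMomentK_eq_add φ hkN F a', hkN2, chainMomentK_succ_eq_zero]
    ring

/-- **The piece `0` carries all the Killing moments**: `∫ pieceK₀ · K_a = ∫ (F Σ_{i ≤ N} φ_i) · K_a`.
[cite: MaoOhTao2023, Lemma 2.2 (proof)] -/
theorem integral_chainPieceK_zero_killingFn (hφ : ∀ i, Continuous (φ i)) (hη : ∀ i, Continuous (η i))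
    (hηc : ∀ i, HasCompactSupport (η i)) {p : ℕ → E3} (hp : ∀ i, 1 ≤ i → i ≤ N → η i (p i) ≠ 0)
    (hF : ∀ j, Continuous (F j)) (hFc : ∀ j, HasCompactSupport (F j)) (a' : Fin 3 ⊕ Fin 3) :
    ∫ x : E3, ∑ j, chainPieceK φ η N F 0 j x * killingFn a' x j =
      ∫ y : E3, ∑ j, F j y * (∑ i ∈ Finset.range (N + 1), φ i y) * killingFn a' y j := by
  have I0 : Integrable fun x : E3 ↦ ∑ j, F j x * φ 0 x * killingFn a' x j :=
    integrable_sum_mul_mul_killingFn hF hFc (hφ 0) a'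
  have Ith : ∀ (i : ℕ) (c : Fin 3 ⊕ Fin 3 → ℝ),
      Integrable fun x : E3 ↦ ∑ j, (∑ a, c a * thetaK (η i) a x j) * killingFn a' x j := fun i c ↦
    integrable_sum_sum_mul_thetaK_killingFn (hη i) (hηc i) c a'
  rw [← chainMomentK_zero_eq hφ N hF hFc a']
  have h10 : ¬ (1 ≤ 0) := Nat.not_succ_le_zero 0
  by_cases hN : 0 + 1 ≤ N
  · have e : (fun x : E3 ↦ ∑ j, chainPieceK φ η N F 0 j x * killingFn a' x j) = fun x ↦
        (∑ j, F j x * φ 0 x * killingFn a' x j) +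
          ∑ j, (∑ a, chainMomentK φ N F 1 a * thetaK (η 1) a x j) * killingFn a' x j := by
      funext x
      simp only [chainPieceK, if_pos hN, h10, if_false, sub_zero, ← Finset.sum_add_distrib]
      exact Finset.sum_congr rfl fun j _ ↦ by ring
    rw [e, integral_add I0 (Ith _ _), integral_sum_sum_mul_thetaK_killingFn (hη _) (hηc _) (hp 1 le_rfl hN) _ a',
      chainMomentK_eq_add φ (Nat.zero_le N) F a']
  · have hN0 : N = 0 := by omega
    have e : (fun x : E3 ↦ ∑ j, chainPieceK φ η N F 0 j x * killingFn a' x j) = fun x ↦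
        ∑ j, F j x * φ 0 x * killingFn a' x j := by
      funext x
      simp only [chainPieceK, if_neg hN, h10, if_false, sub_zero, add_zero]
    rw [e, chainMomentK_eq_add φ (Nat.zero_le N) F a', hN0, chainMomentK_succ_eq_zero, add_zero]

/-- **All pieces of a Killing-moment-free `F` are Killing-moment-free** (`k ≤ N`, `Σφ = 1` on the support of `F`).
[cite: MaoOhTao2023, Lemma 2.2 (proof)] -/
theorem integral_chainPieceK_killingFn_eq_zero_of_moments (hφ : ∀ i, Continuous (φ i))
    (hη : ∀ i, Continuous (η i)) (hηc : ∀ i, HasCompactSupport (η i)) {p : ℕ → E3}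
    (hp : ∀ i, 1 ≤ i → i ≤ N → η i (p i) ≠ 0) (hF : ∀ j, Continuous (F j)) (hFc : ∀ j, HasCompactSupport (F j))
    (hsum : ∀ j x, F j x ≠ 0 → ∑ k ∈ Finset.range (N + 1), φ k x = 1)
    (hmom : ∀ a, ∫ y : E3, ∑ j, F j y * killingFn a y j = 0) {k : ℕ} (hk : k ≤ N) (a' : Fin 3 ⊕ Fin 3) :
    ∫ x : E3, ∑ j, chainPieceK φ η N F k j x * killingFn a' x j = 0 := by
  rcases Nat.eq_zero_or_pos k with h0 | hpos
  · subst h0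
    rw [integral_chainPieceK_zero_killingFn hφ hη hηc hp hF hFc a', ← hmom a']
    refine integral_congr_ae (ae_of_all _ fun y ↦ Finset.sum_congr rfl fun j _ ↦ ?_)
    by_cases hy : F j y = 0
    · simp [hy]
    · simp only [hsum j y hy, mul_one]
  · exact integral_chainPieceK_killingFn_eq_zero hφ hη hηc hp hF hFc hpos hk a'

end MaoOhTao

end Literature.Geometry.Lorentzian
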